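import Literature.NumberTheory.Sieve.BrunTitchmarshShortInterval
import Mathlib.Analysis.SpecialFunctions.Gaussian.FourierTransform
import Mathlib.Analysis.SpecialFunctions.Pow.Complex
import Mathlib.MeasureTheory.Integral.IntervalIntegral.Basic
import HarnessLib

/-!
# The mean value theorem for Dirichlet polynomials supported on the primes

Topic `Literature/NumberTheory/LFunctions`.  Everything in this file is PROVED.  It supplies the
`L²` input of the Granville–Harper–Soundararajan proof of Halász's theorem
(*A more intuitive proof of a sharp version of Halász's theorem*, Proc. AMS 146 (2018), Lemma 1;
*A new proof of Halász's theorem, and its consequences*, Compositio Math. 155 (2019), Lemma 2.6),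
a tool of independent use for mean values of multiplicative functions (vendored in the course of
the decomposition of the named fact `Literature.NumberTheory.Sieve.halaszMontgomeryTenenbaum`,
`Literature/NumberTheory/Sieve/MatomakiRadziwill.lean`):

* `prime_meanValue` — **mean value theorem for Dirichlet polynomials supported on the primes**
  (GHS 2018, Lemma 1; GHS 2019, Lemma 2.6: "for any complex numbers `a_n` and any `T ≥ 1`,
  `∫_{-T}^{T} |∑_{T² ≤ n ≤ x} a_n Λ(n)/n^{it}|² dt ≪ ∑_{T² ≤ n ≤ x} n |a_n|² Λ(n)`"), in the form
  restricted to primes which is all that the proof of Halász's theorem uses: for `T ≥ 1`, every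
  finite set `S` of primes `p ≥ T²` and all coefficients `b`,
  `∫_{-T}^{T} |∑_{p ∈ S} b_p p^{-it}|² dt ≤ C ∑_{p ∈ S} (p / log p) |b_p|²`
  (`b_p = a_p log p` recovers the printed shape).  The point is the factor `1/log p`, which the
  generic mean value theorem (weight `n + T`, see `DirichletMVTSharp.lean` and
  `DirichletPolynomialMeanValue.lean` in the tree) does not give: as GHS remark, the standard
  theorem "would yield a multiplier `Λ(n)²`, rather than `Λ(n)`, on the right hand side".

The proof is the printed route ("inserting a smooth weight `Φ(t/T)` into the integral, expanding
out, and applying a Brun–Titchmarsh upper bound for primes in short intervals"): the Gaussian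
majorant `1_{[-T,T]}(t) ≤ e · e^{-t²/T²}`, the Fourier transform
`∫ e^{-t²/T²} p^{-it} q^{it} dt = √π T e^{-T²(log q - log p)²/4}` (`integral_gaussian_twist`, from
Mathlib's `integral_cexp_quadratic`), the Schur-test symmetrisation with the weights `log p`
(`2|b_p b_q| ≤ |b_p|² log q/log p + |b_q|² log p/log q`, `sum_sum_mul_le_of_symm`), and the prime
mass of the logarithmic shells `j ≤ T |log q - log p| < j + 1` around `p`, which is `≪ p/T` once
`p ≥ T²` by the short-interval Brun–Titchmarsh bound `Literature.NumberTheory.Sieve.sum_log_primes_Ioc_le`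
(`sum_log_mul_gaussian_le`).

## References
* A. Granville, A. J. Harper, K. Soundararajan, *A more intuitive proof of a sharp version of
  Halász's theorem*, Proc. Amer. Math. Soc. 146 (2018), 4099–4104; arXiv:1706.03755, §2, Lemma 1.
  [cite: GranvilleHarperSoundararajan2018, Lemma 1]
* A. Granville, A. J. Harper, K. Soundararajan, *A new proof of Halász's theorem, and its
  consequences*, Compos. Math. 155 (2019), 126–163, Lemma 2.6 (full proof of the lemma).

## Design choices
* `twist n t = n^{-it}` (`Complex.cpow`), `dpoly S b t = ∑_{n ∈ S} b_n n^{-it}`; the statement is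
  over an arbitrary `Finset ℕ` of primes `≥ T²`, so that users can feed dyadic blocks or the
  primes of an interval.
* Absolute constants are existentially quantified outermost (`∃ C, 0 < C ∧ …`); no attempt is made
  to optimise them (`e^{19}` arises from the crude shell weight `(j+1)(j+2)e^{j+1-j²/4} ≤ e^{19-j}`).
-/

noncomputable section

open Finset MeasureTheory Complex
open scoped ComplexConjugate

namespace Literature.NumberTheory.LFunctions

namespace PrimeMeanValue

/-- The twist `n^{-it}` as a complex power. [folklore] -/
def twist (n : ℕ) (t : ℝ) : ℂ := (n : ℂ) ^ (-((t : ℂ) * I))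

/-- `n^{-it} = exp(-i t log n)` for `n ≥ 1`. [folklore] -/
theorem twist_eq_exp {n : ℕ} (hn : 0 < n) (t : ℝ) :
    twist n t = Complex.exp (-(Real.log n : ℂ) * t * I) := by
  rw [twist, Complex.cpow_def_of_ne_zero (by exact_mod_cast hn.ne'), ← Complex.natCast_log]
  congr 1
  ring

/-- `conj (n^{-it}) = exp(i t log n)` for `n ≥ 1`. [folklore] -/
theorem conj_twist_eq_exp {n : ℕ} (hn : 0 < n) (t : ℝ) :
    conj (twist n t) = Complex.exp ((Real.log n : ℂ) * t * I) := by
  rw [twist_eq_exp hn, ← Complex.exp_conj]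
  congr 1
  simp only [map_neg, map_mul, Complex.conj_ofReal, Complex.conj_I]
  ring

/-- `|n^{-it}| = 1` for `n ≥ 1`. [folklore] -/
theorem norm_twist {n : ℕ} (hn : 0 < n) (t : ℝ) : ‖twist n t‖ = 1 := by
  rw [twist_eq_exp hn, show -(Real.log n : ℂ) * t * I = ((-(Real.log n * t) : ℝ) : ℂ) * I by
    push_cast; ring]
  exact Complex.norm_exp_ofReal_mul_I _

/-- The twist is continuous in `t`. [folklore] -/
theorem continuous_twist {n : ℕ} (hn : 0 < n) : Continuous fun t : ℝ => twist n t := by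
  simp_rw [twist_eq_exp hn]
  fun_prop

/-- **The Gaussian kernel.** For `p, q ≥ 1` and `T > 0`,
`∫_ℝ e^{-t²/T²} p^{-it} conj(q^{-it}) dt = √π T exp(-T² (log q - log p)²/4)`
(Mathlib's `integral_cexp_quadratic`). [folklore] -/
theorem integral_gaussian_twist {p q : ℕ} (hp : 0 < p) (hq : 0 < q) {T : ℝ} (hT : 0 < T) :
    ∫ t : ℝ, (Real.exp (-(t ^ 2 / T ^ 2)) : ℂ) * (twist p t * conj (twist q t)) =
      ((Real.sqrt Real.pi * T * Real.exp (-(T ^ 2 * (Real.log q - Real.log p) ^ 2 / 4)) : ℝ) : ℂ) := by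
  set u : ℝ := Real.log q - Real.log p with hu
  set b : ℂ := -(1 / (T : ℂ) ^ 2) with hb
  set c : ℂ := (u : ℂ) * I with hc
  have hT0 : (T : ℂ) ≠ 0 := by exact_mod_cast hT.ne'
  have hbre : b.re < 0 := by
    rw [hb, show -(1 / (T : ℂ) ^ 2) = (((-(1 / T ^ 2)) : ℝ) : ℂ) by push_cast; ring]
    rw [Complex.ofReal_re]
    have : 0 < 1 / T ^ 2 := by positivity
    linarith
  have hint : ∀ t : ℝ, (Real.exp (-(t ^ 2 / T ^ 2)) : ℂ) * (twist p t * conj (twist q t)) =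
      Complex.exp (b * (t : ℂ) ^ 2 + c * t + 0) := by
    intro t
    rw [twist_eq_exp hp, conj_twist_eq_exp hq, Complex.ofReal_exp, ← Complex.exp_add,
      ← Complex.exp_add]
    congr 1
    rw [hb, hc, hu]
    push_cast
    field_simp
    ring
  simp_rw [hint]
  rw [integral_cexp_quadratic hbre]
  -- evaluate the constants
  have h1 : (Real.pi : ℂ) / -b = (((Real.pi * T ^ 2 : ℝ)) : ℂ) := by
    rw [hb, neg_neg]
    push_cast
    field_simp
  have h2 : ((Real.pi : ℂ) / -b) ^ (1 / 2 : ℂ) = ((Real.sqrt Real.pi * T : ℝ) : ℂ) := by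
    rw [h1, show (1 / 2 : ℂ) = ((1 / 2 : ℝ) : ℂ) by push_cast; ring,
      ← Complex.ofReal_cpow (by positivity)]
    congr 1
    rw [← Real.sqrt_eq_rpow, Real.sqrt_mul Real.pi_pos.le, Real.sqrt_sq hT.le]
  have h3 : (0 : ℂ) - c ^ 2 / (4 * b) = ((-(T ^ 2 * u ^ 2 / 4) : ℝ) : ℂ) := by
    rw [hc, hb]
    push_cast
    field_simp
    rw [Complex.I_sq]
    ring
  rw [h2, h3, ← Complex.ofReal_exp, ← Complex.ofReal_mul]

/-- The Dirichlet polynomial `D(t) = ∑_{p ∈ S} b_p p^{-it}`. [folklore] -/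
def dpoly (S : Finset ℕ) (b : ℕ → ℂ) (t : ℝ) : ℂ := ∑ p ∈ S, b p * twist p t

/-- `|D(t)|²` expanded: `|D(t)|² = ∑_{p,q} b_p conj(b_q) p^{-it} conj(q^{-it})` (as a complex
number). [folklore] -/
theorem normSq_dpoly_eq (S : Finset ℕ) (b : ℕ → ℂ) (t : ℝ) :
    ((‖dpoly S b t‖ ^ 2 : ℝ) : ℂ) =
      ∑ p ∈ S, ∑ q ∈ S, b p * conj (b q) * (twist p t * conj (twist q t)) := by
  rw [← Complex.normSq_eq_norm_sq, ← Complex.mul_conj, dpoly, map_sum, Finset.sum_mul_sum]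
  refine Finset.sum_congr rfl fun p _ => Finset.sum_congr rfl fun q _ => ?_
  rw [map_mul]
  ring

/-- `|D(t)| ≤ ∑_p |b_p|` (for `S` avoiding `0`). [folklore] -/
theorem norm_dpoly_le {S : Finset ℕ} (hS : ∀ p ∈ S, 0 < p) (b : ℕ → ℂ) (t : ℝ) :
    ‖dpoly S b t‖ ≤ ∑ p ∈ S, ‖b p‖ := by
  refine (norm_sum_le _ _).trans (Finset.sum_le_sum fun p hp => ?_)
  rw [norm_mul, norm_twist (hS p hp), mul_one]

/-- Continuity of `D`. [folklore] -/
theorem continuous_dpoly {S : Finset ℕ} (hS : ∀ p ∈ S, 0 < p) (b : ℕ → ℂ) :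
    Continuous fun t : ℝ => dpoly S b t := by
  unfold dpoly
  exact continuous_finsetSum _ fun p hp => continuous_const.mul (continuous_twist (hS p hp))

/-- The Gaussian kernel `G(p,q) = √π T exp(-T²(log q - log p)²/4)`. [folklore] -/
def gkernel (T : ℝ) (p q : ℕ) : ℝ :=
  Real.sqrt Real.pi * T * Real.exp (-(T ^ 2 * (Real.log q - Real.log p) ^ 2 / 4))

/-- `G` is symmetric. [folklore] -/
theorem gkernel_comm (T : ℝ) (p q : ℕ) : gkernel T p q = gkernel T q p := by
  unfold gkernel
  congr 3
  ring

/-- `G ≥ 0` for `T ≥ 0`. [folklore] -/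
theorem gkernel_nonneg {T : ℝ} (hT : 0 ≤ T) (p q : ℕ) : 0 ≤ gkernel T p q := by
  unfold gkernel; positivity

/-- **The weighted mean square, exactly**: for `T > 0`,
`∫_ℝ e^{-t²/T²} |D(t)|² dt = ∑_{p,q} G(p,q) Re(b_p conj b_q)`. [folklore] -/
theorem integral_gaussian_normSq_dpoly {S : Finset ℕ} (hS : ∀ p ∈ S, 0 < p) (b : ℕ → ℂ) {T : ℝ}
    (hT : 0 < T) :
    ∫ t : ℝ, Real.exp (-(t ^ 2 / T ^ 2)) * ‖dpoly S b t‖ ^ 2 =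
      ∑ p ∈ S, ∑ q ∈ S, gkernel T p q * (b p * conj (b q)).re := by
  -- the complex integrand
  set Φ : ℝ → ℂ := fun t => ∑ p ∈ S, ∑ q ∈ S,
    b p * conj (b q) * ((Real.exp (-(t ^ 2 / T ^ 2)) : ℂ) * (twist p t * conj (twist q t))) with hΦ
  have hre : ∀ t : ℝ, Real.exp (-(t ^ 2 / T ^ 2)) * ‖dpoly S b t‖ ^ 2 = (Φ t).re := by
    intro t
    have h1 : ((Real.exp (-(t ^ 2 / T ^ 2)) * ‖dpoly S b t‖ ^ 2 : ℝ) : ℂ) = Φ t := by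
      rw [Complex.ofReal_mul, normSq_dpoly_eq, hΦ, Finset.mul_sum]
      refine Finset.sum_congr rfl fun p _ => ?_
      rw [Finset.mul_sum]
      refine Finset.sum_congr rfl fun q _ => ?_
      ring
    rw [← h1, Complex.ofReal_re]
  -- integrability of each term
  have hterm : ∀ p ∈ S, ∀ q ∈ S, Integrable (fun t : ℝ =>
      b p * conj (b q) * ((Real.exp (-(t ^ 2 / T ^ 2)) : ℂ) * (twist p t * conj (twist q t)))) := by
    intro p hp q hq
    refine Integrable.const_mul ?_ _
    have hgauss : Integrable (fun t : ℝ => ((Real.exp (-(t ^ 2 / T ^ 2)) : ℝ) : ℂ)) := by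
      have h1 : Integrable (fun t : ℝ => Real.exp (-(1 / T ^ 2) * t ^ 2)) :=
        integrable_exp_neg_mul_sq (by positivity)
      have h1' : Integrable (fun t : ℝ => Real.exp (-(t ^ 2 / T ^ 2))) := by
        refine h1.congr (Filter.Eventually.of_forall fun t => ?_)
        show Real.exp (-(1 / T ^ 2) * t ^ 2) = Real.exp (-(t ^ 2 / T ^ 2))
        congr 1; ring
      exact h1'.ofReal
    refine hgauss.mul_bdd (c := 1) ?_ (Filter.Eventually.of_forall fun t => ?_)
    · exact ((continuous_twist (hS p hp)).mul
        (Complex.continuous_conj.comp (continuous_twist (hS q hq)))).aestronglyMeasurable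
    · rw [norm_mul, norm_twist (hS p hp), Complex.norm_conj, norm_twist (hS q hq), mul_one]
  have hΦint : Integrable Φ := by
    refine integrable_finsetSum _ fun p hp => integrable_finsetSum _ fun q hq => hterm p hp q hq
  simp_rw [hre]
  have hreint := integral_re hΦint
  simp only [RCLike.re_to_complex] at hreint
  rw [hreint]
  have hΦeval : ∫ t, Φ t = ∑ p ∈ S, ∑ q ∈ S, b p * conj (b q) * (gkernel T p q : ℂ) := by
    rw [hΦ, integral_finsetSum _ (fun p hp => integrable_finsetSum _ fun q hq => hterm p hp q hq)]
    refine Finset.sum_congr rfl fun p hp => ?_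
    rw [integral_finsetSum _ (fun q hq => hterm p hp q hq)]
    refine Finset.sum_congr rfl fun q hq => ?_
    rw [integral_const_mul, integral_gaussian_twist (hS p hp) (hS q hq) hT]
    rfl
  rw [hΦeval, Complex.re_sum]
  refine Finset.sum_congr rfl fun p _ => ?_
  rw [Complex.re_sum]
  refine Finset.sum_congr rfl fun q _ => ?_
  rw [mul_comm, Complex.re_ofReal_mul]

/-- **The Gaussian majorant**: `∫_{-T}^{T} |D|² ≤ e ∫_ℝ e^{-t²/T²} |D(t)|² dt` (`T > 0`), since
`1 ≤ e · e^{-t²/T²}` on `[-T, T]`. [folklore] -/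
theorem intervalIntegral_normSq_dpoly_le {S : Finset ℕ} (hS : ∀ p ∈ S, 0 < p) (b : ℕ → ℂ)
    {T : ℝ} (hT : 0 < T) :
    ∫ t in (-T)..T, ‖dpoly S b t‖ ^ 2 ≤
      Real.exp 1 * ∫ t : ℝ, Real.exp (-(t ^ 2 / T ^ 2)) * ‖dpoly S b t‖ ^ 2 := by
  have hcont : Continuous fun t : ℝ => ‖dpoly S b t‖ ^ 2 := (continuous_dpoly hS b).norm.pow 2
  have hcontg : Continuous fun t : ℝ => Real.exp (-(t ^ 2 / T ^ 2)) * ‖dpoly S b t‖ ^ 2 := by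
    refine Continuous.mul ?_ hcont
    fun_prop
  -- integrability on `ℝ` of the weighted function
  have hint : Integrable (fun t : ℝ => Real.exp (-(t ^ 2 / T ^ 2)) * ‖dpoly S b t‖ ^ 2) := by
    have h1 : Integrable (fun t : ℝ => Real.exp (-(1 / T ^ 2) * t ^ 2)) :=
      integrable_exp_neg_mul_sq (by positivity)
    have h1' : Integrable (fun t : ℝ => Real.exp (-(t ^ 2 / T ^ 2))) := by
      refine h1.congr (Filter.Eventually.of_forall fun t => ?_)
      show Real.exp (-(1 / T ^ 2) * t ^ 2) = Real.exp (-(t ^ 2 / T ^ 2))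
      congr 1; ring
    refine h1'.mul_bdd (c := (∑ p ∈ S, ‖b p‖) ^ 2) hcont.aestronglyMeasurable
      (Filter.Eventually.of_forall fun t => ?_)
    rw [Real.norm_eq_abs, abs_of_nonneg (by positivity)]
    exact pow_le_pow_left₀ (norm_nonneg _) (norm_dpoly_le hS b t) 2
  calc ∫ t in (-T)..T, ‖dpoly S b t‖ ^ 2
      ≤ ∫ t in (-T)..T, Real.exp 1 * (Real.exp (-(t ^ 2 / T ^ 2)) * ‖dpoly S b t‖ ^ 2) := by
        refine intervalIntegral.integral_mono_on (by linarith) (hcont.intervalIntegrable _ _)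
          ((continuous_const.mul hcontg).intervalIntegrable _ _) fun t ht => ?_
        have hexp : 1 ≤ Real.exp 1 * Real.exp (-(t ^ 2 / T ^ 2)) := by
          rw [← Real.exp_add]
          refine Real.one_le_exp ?_
          have ht2 : t ^ 2 ≤ T ^ 2 := by
            rw [Set.mem_Icc] at ht
            nlinarith [ht.1, ht.2]
          have : t ^ 2 / T ^ 2 ≤ 1 := by
            rw [div_le_one (by positivity)]; exact ht2
          linarith
        calc ‖dpoly S b t‖ ^ 2 = 1 * ‖dpoly S b t‖ ^ 2 := (one_mul _).symm
          _ ≤ (Real.exp 1 * Real.exp (-(t ^ 2 / T ^ 2))) * ‖dpoly S b t‖ ^ 2 :=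
              mul_le_mul_of_nonneg_right hexp (by positivity)
          _ = _ := by ring
    _ = Real.exp 1 * ∫ t in (-T)..T, Real.exp (-(t ^ 2 / T ^ 2)) * ‖dpoly S b t‖ ^ 2 := by
        rw [intervalIntegral.integral_const_mul]
    _ ≤ Real.exp 1 * ∫ t : ℝ, Real.exp (-(t ^ 2 / T ^ 2)) * ‖dpoly S b t‖ ^ 2 := by
        refine mul_le_mul_of_nonneg_left ?_ (Real.exp_pos 1).le
        rw [intervalIntegral.integral_of_le (by linarith)]
        exact setIntegral_le_integral hint (Filter.Eventually.of_forall fun t => by positivity)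

/-- **Symmetrisation**: for a symmetric kernel `G ≥ 0` and positive weights `w`,
`∑_{p,q} G(p,q) |b_p| |b_q| ≤ ∑_p (|b_p|²/w_p) ∑_q w_q G(p,q)` (`2xy ≤ x² + y²`). [folklore] -/
theorem sum_sum_mul_le_of_symm {S : Finset ℕ} (G : ℕ → ℕ → ℝ) (hG : ∀ p q, G p q = G q p)
    (hG0 : ∀ p q, 0 ≤ G p q) (w : ℕ → ℝ) (hw : ∀ p ∈ S, 0 < w p) (c : ℕ → ℝ) :
    ∑ p ∈ S, ∑ q ∈ S, G p q * (c p * c q) ≤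
      ∑ p ∈ S, c p ^ 2 / w p * ∑ q ∈ S, w q * G p q := by
  -- termwise: `2 c_p c_q ≤ c_p² w_q/w_p + c_q² w_p/w_q`
  have hkey : ∀ p ∈ S, ∀ q ∈ S,
      2 * (G p q * (c p * c q)) ≤ G p q * (c p ^ 2 * w q / w p) + G p q * (c q ^ 2 * w p / w q) := by
    intro p hp q hq
    have hwp := hw p hp
    have hwq := hw q hq
    have h0 : 0 ≤ (c p * w q - c q * w p) ^ 2 / (w p * w q) := by positivity
    have h1 : (c p * w q - c q * w p) ^ 2 / (w p * w q) =
        c p ^ 2 * w q / w p + c q ^ 2 * w p / w q - 2 * (c p * c q) := by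
      field_simp
      ring
    rw [h1] at h0
    have h2 : 2 * (c p * c q) ≤ c p ^ 2 * w q / w p + c q ^ 2 * w p / w q := by linarith
    have := mul_le_mul_of_nonneg_left h2 (hG0 p q)
    linarith [this]
  have hsum : 2 * ∑ p ∈ S, ∑ q ∈ S, G p q * (c p * c q) ≤
      ∑ p ∈ S, ∑ q ∈ S, G p q * (c p ^ 2 * w q / w p) +
        ∑ p ∈ S, ∑ q ∈ S, G p q * (c q ^ 2 * w p / w q) := by
    rw [Finset.mul_sum, ← Finset.sum_add_distrib]
    refine Finset.sum_le_sum fun p hp => ?_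
    rw [Finset.mul_sum, ← Finset.sum_add_distrib]
    exact Finset.sum_le_sum fun q hq => hkey p hp q hq
  -- the two double sums are equal (swap `p ↔ q`, symmetry of `G`)
  have hswap : ∑ p ∈ S, ∑ q ∈ S, G p q * (c q ^ 2 * w p / w q) =
      ∑ p ∈ S, ∑ q ∈ S, G p q * (c p ^ 2 * w q / w p) := by
    rw [Finset.sum_comm]
    refine Finset.sum_congr rfl fun p _ => Finset.sum_congr rfl fun q _ => ?_
    rw [hG q p]
  rw [hswap] at hsum
  have hfinal : ∑ p ∈ S, ∑ q ∈ S, G p q * (c p ^ 2 * w q / w p) =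
      ∑ p ∈ S, c p ^ 2 / w p * ∑ q ∈ S, w q * G p q := by
    refine Finset.sum_congr rfl fun p hp => ?_
    rw [Finset.mul_sum]
    refine Finset.sum_congr rfl fun q _ => ?_
    have := (hw p hp).ne'
    field_simp
  linarith

end PrimeMeanValue


namespace PrimeMeanValue

/-! ### The arithmetic input: prime mass against the Gaussian kernel -/

/-- `e^{s} - e^{-s} ≤ 2 s e^{s}` for `s ≥ 0`. [folklore] -/
theorem exp_sub_exp_neg_le (s : ℝ) : Real.exp s - Real.exp (-s) ≤ 2 * s * Real.exp s := by
  -- `e^{-2s} ≥ 1 - 2s`, multiplied by `e^{s}`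
  have h1 : 1 - 2 * s ≤ Real.exp (-(2 * s)) := by
    have := Real.add_one_le_exp (-(2 * s)); linarith
  have h2 : Real.exp (-s) = Real.exp s * Real.exp (-(2 * s)) := by
    rw [← Real.exp_add]; ring_nf
  rw [h2]
  nlinarith [Real.exp_pos s, mul_le_mul_of_nonneg_left h1 (Real.exp_pos s).le]

/-- `2 s ≤ e^{s} - e^{-s}` for `s ≥ 0`. [folklore] -/
theorem two_mul_le_exp_sub_exp_neg {s : ℝ} (hs : 0 ≤ s) : 2 * s ≤ Real.exp s - Real.exp (-s) := by
  -- `g(s) = e^s - e^{-s} - 2s` has `g(0) = 0`, `g' = e^s + e^{-s} - 2 ≥ 0`; we use instead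
  -- `e^{s} ≥ 1 + s + s²/2` and `e^{-s} ≤ 1 - s + s²/2`.
  have h1 : 1 + s + s ^ 2 / 2 ≤ Real.exp s := by
    have := Real.quadratic_le_exp_of_nonneg hs
    linarith
  have h2 : Real.exp (-s) ≤ 1 - s + s ^ 2 / 2 := by
    -- `e^{-s} (1 + s + s²/2) ≤ e^{-s} e^{s} = 1`, and `(1 - s + s²/2)(1 + s + s²/2) = 1 + s⁴/4 ≥ 1`
    have h3 : Real.exp (-s) * (1 + s + s ^ 2 / 2) ≤ 1 := by
      calc Real.exp (-s) * (1 + s + s ^ 2 / 2) ≤ Real.exp (-s) * Real.exp s :=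
            mul_le_mul_of_nonneg_left h1 (Real.exp_pos _).le
        _ = 1 := by rw [← Real.exp_add]; simp
    have h4 : (1 : ℝ) ≤ (1 - s + s ^ 2 / 2) * (1 + s + s ^ 2 / 2) := by nlinarith [sq_nonneg (s ^ 2)]
    have h5 : 0 < 1 + s + s ^ 2 / 2 := by positivity
    have h6 : Real.exp (-s) ≤ 1 / (1 + s + s ^ 2 / 2) := by
      rw [le_div_iff₀ h5]; exact h3
    refine h6.trans ?_
    rw [div_le_iff₀ h5]
    exact h4
  linarith

/-- `(j+1)(j+2) e^{j+1} e^{-j²/4} ≤ e^{19} e^{-j}` for `j ∈ ℕ` (crude: `(x)(x+1) ≤ e^{2x}` and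
`3(j+1) - j²/4 ≤ 19 - j`). [folklore] -/
theorem shell_weight_le (j : ℕ) :
    ((j : ℝ) + 1) * ((j : ℝ) + 2) * Real.exp ((j : ℝ) + 1) * Real.exp (-((j : ℝ) ^ 2 / 4)) ≤
      Real.exp 19 * Real.exp (-(j : ℝ)) := by
  have hj : (0 : ℝ) ≤ j := Nat.cast_nonneg j
  set x : ℝ := (j : ℝ) + 1 with hx
  have hx1 : 1 ≤ x := by rw [hx]; linarith
  -- `x (x+1) ≤ e^{2x}`
  have h1 : x * (x + 1) ≤ Real.exp (2 * x) := by
    have := Real.quadratic_le_exp_of_nonneg (show 0 ≤ 2 * x by linarith)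
    nlinarith
  have h2 : ((j : ℝ) + 1) * ((j : ℝ) + 2) = x * (x + 1) := by rw [hx]; ring
  rw [h2]
  calc x * (x + 1) * Real.exp ((j : ℝ) + 1) * Real.exp (-((j : ℝ) ^ 2 / 4))
      ≤ Real.exp (2 * x) * Real.exp ((j : ℝ) + 1) * Real.exp (-((j : ℝ) ^ 2 / 4)) := by
        gcongr
    _ = Real.exp (3 * ((j : ℝ) + 1) - (j : ℝ) ^ 2 / 4) := by
        rw [← Real.exp_add, ← Real.exp_add, hx]; ring_nf
    _ ≤ Real.exp (19 - (j : ℝ)) := by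
        rw [Real.exp_le_exp]
        nlinarith [sq_nonneg ((j : ℝ) - 8)]
    _ = Real.exp 19 * Real.exp (-(j : ℝ)) := by rw [← Real.exp_add]; ring_nf

/-- `∑_{j < J} e^{-j} ≤ 2`. [folklore] -/
theorem sum_exp_neg_le_two (J : ℕ) : ∑ j ∈ range J, Real.exp (-(j : ℝ)) ≤ 2 := by
  have hr0 : 0 ≤ Real.exp (-1) := (Real.exp_pos _).le
  have hr1 : Real.exp (-1) < 1 := by
    have := Real.exp_lt_exp.2 (show (-1 : ℝ) < 0 by norm_num)
    rwa [Real.exp_zero] at this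
  have hgeom := summable_geometric_of_lt_one hr0 hr1
  have heq : ∀ j : ℕ, Real.exp (-(j : ℝ)) = Real.exp (-1) ^ j := fun j => by
    rw [← Real.exp_nat_mul]; ring_nf
  simp_rw [heq]
  refine (hgeom.sum_le_tsum (range J) (fun j _ => by positivity)).trans ?_
  rw [tsum_geometric_of_lt_one hr0 hr1]
  have he : Real.exp (-1) ≤ 1 / 2 := by
    rw [Real.exp_neg, inv_eq_one_div, one_div_le_one_div (Real.exp_pos 1) two_pos]
    have := Real.exp_one_gt_d9; linarith
  rw [inv_le_comm₀ (by linarith) two_pos]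
  linarith

/-- **Prime mass against the Gaussian kernel (Brun–Titchmarsh over logarithmic shells).**
If `∑_{N < q ≤ N+M} log q ≤ C M log(N+M)/log M` for all `N` and `M ≥ 2` (the short-interval
Brun–Titchmarsh bound), then for `T ≥ 1`, an integer `p ≥ max(2, T²)` and any finite set `S` of primes,
`∑_{q ∈ S} log q · exp(-T²(log q - log p)²/4) ≤ 16 e^{19} C p / T`:
the `q` with `j ≤ T|log q - log p| < j+1` lie in `(p e^{-s}, p e^{s})`, `s = (j+1)/T`, an interval of
length `≤ 2pse^s` and `≥ 2p/T ≥ 2√p`, so carry prime mass `≤ 8 C p s(1+s)e^{s}`, against the weight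
`e^{-j²/4}`. [folklore] -/
theorem sum_log_mul_gaussian_le {C : ℝ} (hC : 0 ≤ C)
    (hBT : ∀ N M : ℕ, 2 ≤ M → ∑ q ∈ (Ioc N (N + M)).filter Nat.Prime, Real.log q ≤
      C * M * Real.log ((N + M : ℕ) : ℝ) / Real.log M)
    {T : ℝ} (hT : 1 ≤ T) {p : ℕ} (hp2 : 2 ≤ p) (hpT : T ^ 2 ≤ p) {S : Finset ℕ}
    (hS : ∀ q ∈ S, q.Prime) :
    ∑ q ∈ S, Real.log q * Real.exp (-(T ^ 2 * (Real.log q - Real.log p) ^ 2 / 4)) ≤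
      16 * Real.exp 19 * C * p / T := by
  have hT0 : 0 < T := by linarith
  have hp0 : (0 : ℝ) < p := by exact_mod_cast (zero_lt_two.trans_le hp2)
  have hp2r : (2 : ℝ) ≤ p := by exact_mod_cast hp2
  have hlogp : 0 < Real.log p := Real.log_pos (by linarith)
  have hsqrtp : T ≤ Real.sqrt p := by
    rw [Real.le_sqrt hT0.le hp0.le]; exact hpT
  have hpT' : Real.sqrt p ≤ p / T := by
    rw [le_div_iff₀ hT0]
    calc Real.sqrt p * T ≤ Real.sqrt p * Real.sqrt p :=
          mul_le_mul_of_nonneg_left hsqrtp (Real.sqrt_nonneg _)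
      _ = p := Real.mul_self_sqrt hp0.le
  have hsqrt2 : Real.sqrt 2 ≤ Real.sqrt p := Real.sqrt_le_sqrt hp2r
  have hone_le_sqrtp : 1 ≤ Real.sqrt p := by
    have : (1 : ℝ) ≤ Real.sqrt 2 := by
      rw [Real.le_sqrt zero_le_one (by norm_num)]; norm_num
    linarith
  -- the shell index
  set shell : ℕ → ℕ := fun q => ⌊T * |Real.log q - Real.log p|⌋₊ with hshell
  classical
  rw [← Finset.sum_fiberwise_of_maps_to (g := shell) (t := S.image shell) (fun q hq => mem_image_of_mem _ hq)]
  -- per-shell bound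
  have hshellbd : ∀ j : ℕ, ∑ q ∈ S with shell q = j,
      Real.log q * Real.exp (-(T ^ 2 * (Real.log q - Real.log p) ^ 2 / 4)) ≤
        (8 * C * p / T) * (((j : ℝ) + 1) * ((j : ℝ) + 2) * Real.exp ((j : ℝ) + 1) *
          Real.exp (-((j : ℝ) ^ 2 / 4))) := by
    intro j
    set s : ℝ := ((j : ℝ) + 1) / T with hs_def
    have hs0 : 0 < s := by positivity
    have hsT : 1 / T ≤ s := by
      rw [hs_def]; exact div_le_div_of_nonneg_right (by linarith [Nat.cast_nonneg (α := ℝ) j]) hT0.le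
    have hs_le : s ≤ (j : ℝ) + 1 := by
      rw [hs_def]
      exact div_le_self (by positivity) hT
    -- the interval `(N, N + M]`
    set L : ℝ := p * (Real.exp s - Real.exp (-s)) with hL
    set N : ℕ := ⌊p * Real.exp (-s)⌋₊ with hN
    set M : ℕ := ⌈L⌉₊ + 1 with hM
    have hL_lower : 2 * p * s ≤ L := by
      rw [hL]
      have := mul_le_mul_of_nonneg_left (two_mul_le_exp_sub_exp_neg hs0.le) hp0.le
      linarith
    have hps : Real.sqrt p ≤ p * s := by
      calc Real.sqrt p ≤ p / T := hpT'
        _ = p * (1 / T) := by ring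
        _ ≤ p * s := mul_le_mul_of_nonneg_left hsT hp0.le
    have hL2 : 2 ≤ L := by
      have : (2 : ℝ) * 1 ≤ 2 * (p * s) := by linarith
      linarith
    have hL_upper : L ≤ 2 * p * s * Real.exp s := by
      rw [hL]
      have := mul_le_mul_of_nonneg_left (exp_sub_exp_neg_le s) hp0.le
      linarith
    have hM2 : 2 ≤ M := by
      rw [hM]
      have : 1 ≤ ⌈L⌉₊ := Nat.one_le_ceil_iff.2 (by linarith)
      omega
    have hMr : (M : ℝ) ≤ 2 * L := by
      rw [hM]; push_cast
      have := (Nat.ceil_lt_add_one (show 0 ≤ L by linarith)).le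
      linarith
    have hMr' : (M : ℝ) ≤ 4 * p * s * Real.exp s := by linarith
    have hNr : (N : ℝ) ≤ p * Real.exp (-s) := Nat.floor_le (by positivity)
    have hNr' : p * Real.exp (-s) < N + 1 := Nat.lt_floor_add_one _
    have hpes : (p : ℝ) ≤ p * Real.exp s :=
      le_mul_of_one_le_right hp0.le (Real.one_le_exp hs0.le)
    have hNM_upper : ((N + M : ℕ) : ℝ) ≤ 3 * p * Real.exp s := by
      push_cast
      have h1 : (N : ℝ) + M ≤ p * Real.exp (-s) + 2 * L := by linarith
      have h2 : p * Real.exp (-s) + L = p * Real.exp s := by rw [hL]; ring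
      have h3 : L ≤ p * Real.exp s := by
        have : 0 < p * Real.exp (-s) := by positivity
        linarith
      have h4 : 0 ≤ (p : ℝ) * Real.exp s := by positivity
      linarith
    -- the fibre is inside the primes of `(N, N + M]`
    have hsub : (S.filter fun q => shell q = j) ⊆ (Ioc N (N + M)).filter Nat.Prime := by
      intro q hq
      rw [Finset.mem_filter] at hq ⊢
      obtain ⟨hqS, hqj⟩ := hq
      have hqprime := hS q hqS
      have hq0 : (0 : ℝ) < q := by exact_mod_cast hqprime.pos
      refine ⟨?_, hqprime⟩
      -- `T |log q - log p| < j + 1`, i.e. `|log q - log p| < s`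
      have hlt : T * |Real.log q - Real.log p| < (j : ℝ) + 1 := by
        have := Nat.lt_floor_add_one (T * |Real.log q - Real.log p|)
        rw [show ⌊T * |Real.log q - Real.log p|⌋₊ = j from hqj] at this
        exact_mod_cast this
      have habs : |Real.log q - Real.log p| < s := by
        rw [hs_def, lt_div_iff₀ hT0, mul_comm]; exact hlt
      rw [abs_lt] at habs
      have hq_upper : (q : ℝ) < p * Real.exp s := by
        have h1 : Real.log q < Real.log p + s := by linarith [habs.2]
        calc (q : ℝ) = Real.exp (Real.log q) := (Real.exp_log hq0).symm
          _ < Real.exp (Real.log p + s) := Real.exp_lt_exp.2 h1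
          _ = p * Real.exp s := by rw [Real.exp_add, Real.exp_log hp0]
      have hq_lower : p * Real.exp (-s) < q := by
        have h1 : Real.log p - s < Real.log q := by linarith [habs.1]
        calc p * Real.exp (-s) = Real.exp (Real.log p - s) := by
              rw [sub_eq_add_neg, Real.exp_add, Real.exp_log hp0]
          _ < Real.exp (Real.log q) := Real.exp_lt_exp.2 h1
          _ = q := Real.exp_log hq0
      rw [Finset.mem_Ioc]
      constructor
      · -- `N ≤ p e^{-s} < q`
        have : (N : ℝ) < q := lt_of_le_of_lt hNr hq_lower
        exact_mod_cast this
      · -- `q < p e^{s} = p e^{-s} + L < N + 1 + (M - 1)`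
        have h2 : p * Real.exp s = p * Real.exp (-s) + L := by rw [hL]; ring
        have h3 : L ≤ ⌈L⌉₊ := Nat.le_ceil L
        have h4 : (q : ℝ) < (N : ℝ) + 1 + ⌈L⌉₊ := by linarith
        have h5 : (q : ℝ) < ((N + M : ℕ) : ℝ) := by rw [hM]; push_cast; linarith
        exact_mod_cast h5.le
    -- weight on the fibre
    have hweight : ∀ q ∈ S.filter (fun q => shell q = j),
        Real.exp (-(T ^ 2 * (Real.log q - Real.log p) ^ 2 / 4)) ≤ Real.exp (-((j : ℝ) ^ 2 / 4)) := by
      intro q hq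
      rw [Finset.mem_filter] at hq
      obtain ⟨-, hqj⟩ := hq
      have hge : (j : ℝ) ≤ T * |Real.log q - Real.log p| := by
        have := Nat.floor_le (show 0 ≤ T * |Real.log q - Real.log p| by positivity)
        rw [show ⌊T * |Real.log q - Real.log p|⌋₊ = j from hqj] at this
        exact this
      rw [Real.exp_le_exp, neg_le_neg_iff]
      have h1 : (j : ℝ) ^ 2 ≤ (T * |Real.log q - Real.log p|) ^ 2 :=
        pow_le_pow_left₀ (Nat.cast_nonneg j) hge 2
      rw [mul_pow, sq_abs] at h1
      linarith
    -- assemble the fibre bound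
    calc ∑ q ∈ S with shell q = j, Real.log q * Real.exp (-(T ^ 2 * (Real.log q - Real.log p) ^ 2 / 4))
        ≤ ∑ q ∈ S with shell q = j, Real.log q * Real.exp (-((j : ℝ) ^ 2 / 4)) := by
          refine Finset.sum_le_sum fun q hq => ?_
          have hqprime := hS q (Finset.mem_filter.1 hq).1
          exact mul_le_mul_of_nonneg_left (hweight q hq)
            (Real.log_nonneg (by exact_mod_cast hqprime.one_lt.le))
      _ = Real.exp (-((j : ℝ) ^ 2 / 4)) * ∑ q ∈ S with shell q = j, Real.log q := by
          rw [Finset.mul_sum]; exact Finset.sum_congr rfl fun q _ => mul_comm _ _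
      _ ≤ Real.exp (-((j : ℝ) ^ 2 / 4)) * ∑ q ∈ (Ioc N (N + M)).filter Nat.Prime, Real.log q := by
          refine mul_le_mul_of_nonneg_left ?_ (Real.exp_pos _).le
          exact Finset.sum_le_sum_of_subset_of_nonneg hsub fun q hq _ =>
            Real.log_nonneg (by exact_mod_cast (Finset.mem_filter.1 hq).2.one_lt.le)
      _ ≤ Real.exp (-((j : ℝ) ^ 2 / 4)) * (C * M * Real.log ((N + M : ℕ) : ℝ) / Real.log M) :=
          mul_le_mul_of_nonneg_left (hBT N M hM2) (Real.exp_pos _).le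
      _ ≤ Real.exp (-((j : ℝ) ^ 2 / 4)) * (8 * C * p * s * (1 + s) * Real.exp s) := by
          refine mul_le_mul_of_nonneg_left ?_ (Real.exp_pos _).le
          -- `log(N+M)/log M ≤ 2 (1 + s)` and `M ≤ 4 p s e^s`
          have hM0 : (0 : ℝ) < M := by exact_mod_cast (zero_lt_two.trans_le hM2)
          have hlogM : Real.log 2 + Real.log p / 2 ≤ Real.log M := by
            have h1 : 2 * Real.sqrt p ≤ M := by
              have : (2 : ℝ) * Real.sqrt p ≤ 2 * p * s := by linarith
              have hM_ge : L ≤ M := by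
                rw [hM]; push_cast; linarith [Nat.le_ceil L]
              linarith
            have h2 := Real.log_le_log (by positivity) h1
            rw [Real.log_mul two_ne_zero (by positivity), Real.log_sqrt hp0.le] at h2
            linarith
          have hlogM0 : 0 < Real.log M := by
            have : 0 < Real.log 2 := Real.log_pos one_lt_two
            have : 0 ≤ Real.log p / 2 := by positivity
            linarith
          have hlogNM : Real.log ((N + M : ℕ) : ℝ) ≤ Real.log 3 + Real.log p + s := by
            have h0 : (0 : ℝ) < ((N + M : ℕ) : ℝ) := by positivity
            have h1 := Real.log_le_log h0 hNM_upper
            rw [Real.log_mul (by positivity) (Real.exp_pos s).ne', Real.log_mul (by norm_num) hp0.ne',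
              Real.log_exp] at h1
            linarith
          have hlog3 : Real.log 3 ≤ 2 * Real.log 2 := by
            have h34 : Real.log 3 ≤ Real.log 4 := Real.log_le_log (by norm_num) (by norm_num)
            have h4 : Real.log 4 = 2 * Real.log 2 := by
              rw [show (4 : ℝ) = 2 ^ 2 by norm_num, Real.log_pow]; push_cast; ring
            linarith
          have hratio : Real.log ((N + M : ℕ) : ℝ) / Real.log M ≤ 2 * (1 + s) := by
            rw [div_le_iff₀ hlogM0]
            have hlog2 : 0 < Real.log 2 := Real.log_pos one_lt_two
            -- log 3 + log p + s ≤ 2(1+s)(log 2 + log p /2) = 2 log 2 + log p + 2 s log 2 + s log p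
            have : Real.log 3 + Real.log p + s ≤ 2 * (1 + s) * (Real.log 2 + Real.log p / 2) := by
              have hl2 : (0.6931471803 : ℝ) < Real.log 2 := Real.log_two_gt_d9
              have e1 : 2 * (1 + s) * (Real.log 2 + Real.log p / 2) =
                  2 * Real.log 2 + Real.log p + s * (2 * Real.log 2) + s * Real.log p := by ring
              rw [e1]
              have hsp : 0 ≤ s * Real.log p := by positivity
              have hs2 : s ≤ s * (2 * Real.log 2) := le_mul_of_one_le_right hs0.le (by linarith)
              linarith
            calc Real.log ((N + M : ℕ) : ℝ) ≤ Real.log 3 + Real.log p + s := hlogNM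
              _ ≤ 2 * (1 + s) * (Real.log 2 + Real.log p / 2) := this
              _ ≤ 2 * (1 + s) * Real.log M :=
                  mul_le_mul_of_nonneg_left hlogM (by positivity)
          calc C * M * Real.log ((N + M : ℕ) : ℝ) / Real.log M
              = C * M * (Real.log ((N + M : ℕ) : ℝ) / Real.log M) := by ring
            _ ≤ C * (4 * p * s * Real.exp s) * (2 * (1 + s)) := by
                refine mul_le_mul (mul_le_mul_of_nonneg_left hMr' hC) hratio
                  (div_nonneg (Real.log_nonneg ?_) hlogM0.le) (by positivity)
                have : (1 : ℕ) ≤ N + M := by omega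
                exact_mod_cast this
            _ = 8 * C * p * s * (1 + s) * Real.exp s := by ring
      _ ≤ (8 * C * p / T) * (((j : ℝ) + 1) * ((j : ℝ) + 2) * Real.exp ((j : ℝ) + 1) *
            Real.exp (-((j : ℝ) ^ 2 / 4))) := by
          -- `s (1+s) e^s ≤ ((j+1)/T) (j+2) e^{j+1}`
          have h1 : (1 + s) ≤ (j : ℝ) + 2 := by linarith
          have h2 : Real.exp s ≤ Real.exp ((j : ℝ) + 1) := Real.exp_le_exp.2 hs_le
          have h3 : s * (1 + s) * Real.exp s ≤ s * ((j : ℝ) + 2) * Real.exp ((j : ℝ) + 1) := by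
            gcongr
          have h4 : Real.exp (-((j : ℝ) ^ 2 / 4)) * (8 * C * p * s * (1 + s) * Real.exp s) =
              (8 * C * p) * (s * (1 + s) * Real.exp s) * Real.exp (-((j : ℝ) ^ 2 / 4)) := by ring
          rw [h4]
          have h5 : (8 * C * p) * (s * (1 + s) * Real.exp s) * Real.exp (-((j : ℝ) ^ 2 / 4)) ≤
              (8 * C * p) * (s * ((j : ℝ) + 2) * Real.exp ((j : ℝ) + 1)) * Real.exp (-((j : ℝ) ^ 2 / 4)) := by
            gcongr
          refine h5.trans (le_of_eq ?_)
          rw [hs_def]; ring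
  -- sum over the shells
  set J := S.image shell with hJ
  have hJsub : J ⊆ range (J.sup id + 1) := fun j hj =>
    Finset.mem_range.2 (Nat.lt_succ_of_le (Finset.le_sup (f := id) hj))
  calc ∑ j ∈ J, ∑ q ∈ S with shell q = j,
        Real.log q * Real.exp (-(T ^ 2 * (Real.log q - Real.log p) ^ 2 / 4))
      ≤ ∑ j ∈ J, (8 * C * p / T) * (((j : ℝ) + 1) * ((j : ℝ) + 2) * Real.exp ((j : ℝ) + 1) *
          Real.exp (-((j : ℝ) ^ 2 / 4))) := Finset.sum_le_sum fun j _ => hshellbd j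
    _ ≤ ∑ j ∈ range (J.sup id + 1), (8 * C * p / T) * (((j : ℝ) + 1) * ((j : ℝ) + 2) *
          Real.exp ((j : ℝ) + 1) * Real.exp (-((j : ℝ) ^ 2 / 4))) :=
        Finset.sum_le_sum_of_subset_of_nonneg hJsub fun j _ _ => by positivity
    _ ≤ ∑ j ∈ range (J.sup id + 1), (8 * C * p / T) * (Real.exp 19 * Real.exp (-(j : ℝ))) :=
        Finset.sum_le_sum fun j _ => mul_le_mul_of_nonneg_left (shell_weight_le j) (by positivity)
    _ = (8 * C * p / T) * Real.exp 19 * ∑ j ∈ range (J.sup id + 1), Real.exp (-(j : ℝ)) := by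
        rw [Finset.mul_sum]; exact Finset.sum_congr rfl fun j _ => by ring
    _ ≤ (8 * C * p / T) * Real.exp 19 * 2 :=
        mul_le_mul_of_nonneg_left (sum_exp_neg_le_two _) (by positivity)
    _ = 16 * Real.exp 19 * C * p / T := by ring

/-! ### The mean value theorem -/

/-- **Mean value theorem for Dirichlet polynomials supported on the primes**
(Granville–Harper–Soundararajan, *A more intuitive proof of a sharp version of Halász's theorem*,
Lemma 1; *A new proof of Halász's theorem, and its consequences*, Lemma 2.6: "for any complex
numbers `a_n` and any `T ≥ 1`, `∫_{-T}^{T} |∑_{T² ≤ n ≤ x} a_n Λ(n)/n^{it}|² dt ≪ ∑_{T² ≤ n ≤ x} n |a_n|² Λ(n)`"),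
in the form restricted to primes (`b_p = a_p log p`, which is all that the proof of Halász's
theorem uses): there is an absolute `C` such that for `T ≥ 1`, every finite set `S` of primes
`p ≥ T²` and all coefficients `b`,
`∫_{-T}^{T} |∑_{p ∈ S} b_p p^{-it}|² dt ≤ C ∑_{p ∈ S} (p / log p) |b_p|²`.
Proof (the printed one with the Gaussian `e · e^{-t²/T²} ≥ 1_{[-T,T]}` as majorant in place of a
band-limited one): expand the square, `∫_ℝ e^{-t²/T²} p^{-it} q^{it} dt = √π T e^{-T²log²(q/p)/4}`,
`2|b_p b_q| ≤ |b_p|² log q/log p + |b_q|² log p/log q`, and the prime mass of the logarithmic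
shells around `p` is `≪ p/T` by Brun–Titchmarsh (`sum_log_mul_gaussian_le`).
[cite: GranvilleHarperSoundararajan2018, Lemma 1] -/
theorem prime_meanValue :
    ∃ C : ℝ, 0 < C ∧ ∀ T : ℝ, 1 ≤ T → ∀ S : Finset ℕ, (∀ p ∈ S, p.Prime ∧ T ^ 2 ≤ (p : ℝ)) →
      ∀ b : ℕ → ℂ,
        ∫ t in (-T)..T, ‖dpoly S b t‖ ^ 2 ≤ C * ∑ p ∈ S, (p : ℝ) / Real.log p * ‖b p‖ ^ 2 := by
  obtain ⟨C₀, hC₀, hBT⟩ := Sieve.sum_log_primes_Ioc_le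
  set K : ℝ := Real.sqrt Real.pi * (16 * Real.exp 19 * C₀) with hK
  refine ⟨Real.exp 1 * K + 1, by positivity, fun T hT S hS b => ?_⟩
  have hT0 : 0 < T := by linarith
  have hSpos : ∀ p ∈ S, 0 < p := fun p hp => (hS p hp).1.pos
  have hlogpos : ∀ p ∈ S, 0 < Real.log p := fun p hp =>
    Real.log_pos (by exact_mod_cast (hS p hp).1.one_lt)
  have h1 := intervalIntegral_normSq_dpoly_le hSpos b hT0
  rw [integral_gaussian_normSq_dpoly hSpos b hT0] at h1
  -- `∑ G Re(b_p conj b_q) ≤ ∑ G |b_p| |b_q|`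
  have h3 : ∑ p ∈ S, ∑ q ∈ S, gkernel T p q * (b p * conj (b q)).re ≤
      ∑ p ∈ S, ∑ q ∈ S, gkernel T p q * (‖b p‖ * ‖b q‖) := by
    refine Finset.sum_le_sum fun p _ => Finset.sum_le_sum fun q _ =>
      mul_le_mul_of_nonneg_left ?_ (gkernel_nonneg hT0.le p q)
    calc (b p * conj (b q)).re ≤ ‖b p * conj (b q)‖ := Complex.re_le_norm _
      _ = ‖b p‖ * ‖b q‖ := by rw [norm_mul, Complex.norm_conj]
  -- symmetrisation with the weights `log p`
  have h4 := sum_sum_mul_le_of_symm (S := S) (gkernel T) (gkernel_comm T) (gkernel_nonneg hT0.le)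
    (fun p => Real.log p) hlogpos (fun p => ‖b p‖)
  -- the inner sums
  have h5 : ∀ p ∈ S, ∑ q ∈ S, Real.log q * gkernel T p q ≤ K * p := by
    intro p hp
    have hp2 : 2 ≤ p := (hS p hp).1.two_le
    have hin := sum_log_mul_gaussian_le hC₀.le hBT hT hp2 (hS p hp).2 (S := S) fun q hq => (hS q hq).1
    have hrw : ∑ q ∈ S, Real.log q * gkernel T p q =
        Real.sqrt Real.pi * T *
          ∑ q ∈ S, Real.log q * Real.exp (-(T ^ 2 * (Real.log q - Real.log p) ^ 2 / 4)) := by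
      rw [Finset.mul_sum]
      refine Finset.sum_congr rfl fun q _ => ?_
      unfold gkernel; ring
    rw [hrw]
    calc Real.sqrt Real.pi * T *
          ∑ q ∈ S, Real.log q * Real.exp (-(T ^ 2 * (Real.log q - Real.log p) ^ 2 / 4))
        ≤ Real.sqrt Real.pi * T * (16 * Real.exp 19 * C₀ * p / T) :=
          mul_le_mul_of_nonneg_left hin (by positivity)
      _ = K * p := by rw [hK]; field_simp
  have hsum_nonneg : 0 ≤ ∑ p ∈ S, (p : ℝ) / Real.log p * ‖b p‖ ^ 2 :=
    Finset.sum_nonneg fun p hp => by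
      have := hlogpos p hp
      positivity
  calc ∫ t in (-T)..T, ‖dpoly S b t‖ ^ 2
      ≤ Real.exp 1 * ∑ p ∈ S, ∑ q ∈ S, gkernel T p q * (b p * conj (b q)).re := h1
    _ ≤ Real.exp 1 * ∑ p ∈ S, ∑ q ∈ S, gkernel T p q * (‖b p‖ * ‖b q‖) :=
        mul_le_mul_of_nonneg_left h3 (Real.exp_pos 1).le
    _ ≤ Real.exp 1 * ∑ p ∈ S, ‖b p‖ ^ 2 / Real.log p * ∑ q ∈ S, Real.log q * gkernel T p q :=
        mul_le_mul_of_nonneg_left h4 (Real.exp_pos 1).le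
    _ ≤ Real.exp 1 * ∑ p ∈ S, ‖b p‖ ^ 2 / Real.log p * (K * p) := by
        refine mul_le_mul_of_nonneg_left (Finset.sum_le_sum fun p hp => ?_) (Real.exp_pos 1).le
        exact mul_le_mul_of_nonneg_left (h5 p hp)
          (div_nonneg (sq_nonneg _) (hlogpos p hp).le)
    _ = (Real.exp 1 * K) * ∑ p ∈ S, (p : ℝ) / Real.log p * ‖b p‖ ^ 2 := by
        rw [Finset.mul_sum, Finset.mul_sum]
        refine Finset.sum_congr rfl fun p hp => ?_
        have := (hlogpos p hp).ne'
        field_simp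
    _ ≤ (Real.exp 1 * K + 1) * ∑ p ∈ S, (p : ℝ) / Real.log p * ‖b p‖ ^ 2 := by
        nlinarith


end PrimeMeanValue

end Literature.NumberTheory.LFunctions
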